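import Summits.ValiantsHypothesis.ValiantsHypothesis.Theses.SchenstedIndex

/-!
# Strategist sketch — typed decomposition candidates for `OneFactorisationBandLimit` (K1)

Crux item stmt-ValiantsHypothesis-16081, route-ValiantsHypothesis-SchenstedIndex.
Every candidate split `X₁ ∧ … ∧ X_k → K1` considered in STRATEGY-CENSUS.md is typed here over the
route's own objects, and where the seam is provable now it is proved, so that the census can quote
(b) the seam and (c) the equivalences exactly.
-/

open scoped BigOperators

namespace Summit.ValiantsHypothesis.ValiantsHypothesis.Cruxes.OneFactorisationBandLimit.Census

open Summit.ValiantsHypothesis.ValiantsHypothesis.Theses.SchenstedIndex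

/-! ## The route's objects, named -/

/-- slots of the sector `t·J_m` -/
abbrev Slot (t m : ℕ) := Fin t × Fin m × Fin m

/-- set partitions of the slots into blocks of size `m` -/
abbrev SP (t m : ℕ) :=
  {π : Finpartition (Finset.univ : Finset (Slot t m)) // ∀ B ∈ π.parts, B.card = m}

/-- the 1-factorisation indicator `1_OF(t,m)` -/
noncomputable def indOF (t m : ℕ) : SP t m → ℂ := fun π =>
  if (∀ B ∈ π.1.parts, (B.image fun s => s.2.1).card = m ∧ (B.image fun s => s.2.2).card = m)
  then (1 : ℂ) else 0

/-- the block-cycle vector `v_X` of a slot matrix -/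
noncomputable def blockCycle (t m : ℕ) (X : Matrix (Slot t m) (Slot t m) ℂ) : SP t m → ℂ := fun π =>
  ∏ B ∈ π.1.parts, ∑ q : Fin m ≃ ↥B, ∏ i : Fin m, X (q i).1 (q (finRotate m i)).1

/-- `span_n(t,m)` -/
noncomputable def spanN (t m n : ℕ) : Submodule ℂ (SP t m → ℂ) :=
  Submodule.span ℂ (Set.range fun X : {X : Matrix (Slot t m) (Slot t m) ℂ // X.rank ≤ n} =>
    blockCycle t m X.1)

/-- separation at `(t,m,n)`: `1_OF(t,m) ∉ span_n(t,m)` -/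
def Sep (t m n : ℕ) : Prop := indOF t m ∉ spanN t m n

/-- the quasi-polynomial window top `N_c(m) = 2^((log₂ m + c)^c)` -/
def windowTop (c m : ℕ) : ℕ := 2 ^ ((Nat.log 2 m + c) ^ c)

/-- K1 in this vocabulary (definitionally the route decl). -/
theorem K1_iff :
    OneFactorisationBandLimit ↔
      ∀ c m₀ : ℕ, ∃ m : ℕ, m₀ ≤ m ∧ 1 ≤ m ∧
        ∀ e : ℕ, m + e ≤ windowTop c m → ∃ t : ℕ, Sep t m (m + e) :=
  Iff.rfl

/-- monotonicity of `span_n` in the rank bound (the only structure of K1 provable for free). -/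
theorem spanN_mono {t m n n' : ℕ} (h : n ≤ n') : spanN t m n ≤ spanN t m n' := by
  apply Submodule.span_mono
  rintro _ ⟨X, rfl⟩
  exact ⟨⟨X.1, X.2.trans h⟩, rfl⟩

theorem Sep.anti {t m n n' : ℕ} (h : n ≤ n') (hs : Sep t m n') : Sep t m n :=
  fun hmem => hs (spanN_mono h hmem)

/-! ## D1 — window-top form (single width per `m`) : a RESTATEMENT (both directions proved) -/

/-- `K1Top`: one multiplicity `t` witnesses separation at the TOP width of the window. -/
def K1Top : Prop :=
  ∀ c m₀ : ℕ, ∃ m : ℕ, m₀ ≤ m ∧ 1 ≤ m ∧ (m ≤ windowTop c m → ∃ t : ℕ, Sep t m (windowTop c m))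

theorem K1_of_K1Top : K1Top → OneFactorisationBandLimit := by
  intro h c m₀
  obtain ⟨m, hm₀, hm1, hw⟩ := h c m₀
  refine ⟨m, hm₀, hm1, fun e he => ?_⟩
  obtain ⟨t, ht⟩ := hw ((Nat.le_add_right m e).trans he)
  exact ⟨t, ht.anti he⟩

theorem K1Top_of_K1 : OneFactorisationBandLimit → K1Top := by
  intro h c m₀
  obtain ⟨m, hm₀, hm1, hw⟩ := h c m₀
  refine ⟨m, hm₀, hm1, fun hle => ?_⟩
  have hle' : m ≤ 2 ^ ((Nat.log 2 m + c) ^ c) := hle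
  have heq : m + (2 ^ ((Nat.log 2 m + c) ^ c) - m) = 2 ^ ((Nat.log 2 m + c) ^ c) := by omega
  obtain ⟨t, ht⟩ := hw (2 ^ ((Nat.log 2 m + c) ^ c) - m) (by omega)
  refine ⟨t, ?_⟩
  rw [heq] at ht
  exact ht

/-- so D1 cuts nothing: `K1Top ↔ K1` (would be a landed iff ⇒ violates (c)). -/
theorem K1Top_iff : K1Top ↔ OneFactorisationBandLimit := ⟨K1_of_K1Top, K1Top_of_K1⟩

/-! ## D2 — duality split over a NAMED certificate family `a` -/

/-- the pairing functional `f ↦ Σ_π a(π) f(π)` -/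
noncomputable def pairing {ι : Type*} [Fintype ι] (a : ι → ℂ) : (ι → ℂ) →ₗ[ℂ] ℂ where
  toFun f := ∑ i, a i * f i
  map_add' f g := by
    simp only [Pi.add_apply, mul_add, Finset.sum_add_distrib]
  map_smul' c f := by
    simp only [Pi.smul_apply, smul_eq_mul, RingHom.id_apply, Finset.mul_sum]
    refine Finset.sum_congr rfl fun i _ => ?_
    ring

/-- `CertVanish a`: every member of the family is an EQUATION of `span_n` (a ⊥ all block-cycle vectors
of rank ≤ n slot matrices). For an explicit `a` this is the soundness THEOREM of the certificate. -/
def CertVanish (a : (t m n : ℕ) → SP t m → ℂ) : Prop :=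
  ∀ t m n : ℕ, ∀ X : Matrix (Slot t m) (Slot t m) ℂ, X.rank ≤ n →
    pairing (a t m n) (blockCycle t m X) = 0

/-- `CertDetect a`: in the window some member of the family SEES the permanent (⟨a, 1_OF⟩ ≠ 0). -/
def CertDetect (a : (t m n : ℕ) → SP t m → ℂ) : Prop :=
  ∀ c m₀ : ℕ, ∃ m : ℕ, m₀ ≤ m ∧ 1 ≤ m ∧
    ∀ e : ℕ, m + e ≤ windowTop c m → ∃ t : ℕ, pairing (a t m (m + e)) (indOF t m) ≠ 0

/-- The duality seam (finite-dimensional Hahn–Banach-free direction), PROVED: 14 lines. -/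
theorem K1_of_cert (a : (t m n : ℕ) → SP t m → ℂ) :
    CertVanish a → CertDetect a → OneFactorisationBandLimit := by
  intro hV hD c m₀
  obtain ⟨m, hm₀, hm1, hw⟩ := hD c m₀
  refine ⟨m, hm₀, hm1, fun e he => ?_⟩
  obtain ⟨t, ht⟩ := hw e he
  refine ⟨t, fun hmem => ht ?_⟩
  -- `span_n ≤ ker ⟨a, ·⟩` because `a` kills every generator
  have hle : spanN t m (m + e) ≤ LinearMap.ker (pairing (a t m (m + e))) := by
    refine Submodule.span_le.mpr ?_
    rintro _ ⟨X, rfl⟩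
    exact (LinearMap.mem_ker).2 (hV t m (m + e) X.1 X.2)
  exact (LinearMap.mem_ker).1 (hle hmem)

/-- … and conversely every proof of K1 IS such a pair for SOME `a` (finite-dimensional duality), so with
`a` left existential the split is K1 itself; D2 is a decomposition only once `a` is NAMED. The
existential packaging, typed: -/
def CertExists : Prop :=
  ∃ a : (t m n : ℕ) → SP t m → ℂ, CertVanish a ∧ CertDetect a

theorem K1_of_certExists : CertExists → OneFactorisationBandLimit :=
  fun ⟨a, hV, hD⟩ => K1_of_cert a hV hD

/-! ## D3 — general (sub-)sectors + sector monotonicity -/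

/-- set partitions of a sub-multigraph `A ⊆ t·K_{m,m}` (a general bipartite multigraph `w ≤ t·J_m`)
into `m`-blocks -/
abbrev SPsub (t m : ℕ) (A : Finset (Slot t m)) :=
  {π : Finpartition A // ∀ B ∈ π.parts, B.card = m}

noncomputable def indOFsub (t m : ℕ) (A : Finset (Slot t m)) : SPsub t m A → ℂ := fun π =>
  if (∀ B ∈ π.1.parts, (B.image fun s => s.2.1).card = m ∧ (B.image fun s => s.2.2).card = m)
  then (1 : ℂ) else 0

noncomputable def blockCycleSub (t m : ℕ) (A : Finset (Slot t m))
    (X : Matrix (Slot t m) (Slot t m) ℂ) : SPsub t m A → ℂ := fun π =>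
  ∏ B ∈ π.1.parts, ∑ q : Fin m ≃ ↥B, ∏ i : Fin m, X (q i).1 (q (finRotate m i)).1

noncomputable def spanNsub (t m : ℕ) (A : Finset (Slot t m)) (n : ℕ) :
    Submodule ℂ (SPsub t m A → ℂ) :=
  Submodule.span ℂ (Set.range fun X : {X : Matrix (Slot t m) (Slot t m) ℂ // X.rank ≤ n} =>
    blockCycleSub t m A X.1)

def SepSub (t m : ℕ) (A : Finset (Slot t m)) (n : ℕ) : Prop :=
  indOFsub t m A ∉ spanNsub t m A n

/-- `MagicSectorWitness`: witnesses may live in ANY sector `w ≤ t·J_m` (e.g. `J_3 + 2I`, where the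
card's cheapest certificates live), not only in `t·J_m`. A CONSEQUENCE of K1 (take `A = univ`). -/
def MagicSectorWitness : Prop :=
  ∀ c m₀ : ℕ, ∃ m : ℕ, m₀ ≤ m ∧ 1 ≤ m ∧
    ∀ e : ℕ, m + e ≤ windowTop c m → ∃ t : ℕ, ∃ A : Finset (Slot t m), SepSub t m A (m + e)

/-- `SectorMonotone`: separation in a sub-sector lifts to the full sector (card: "n_*(w+w') ≥ n_*(w),
structure for free"; on paper: multiply the weight-w equation by a product of per-monomial coefficient
functionals of weight w'). TRUE on paper, M-sized in Lean. -/
def SectorMonotone : Prop :=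
  ∀ t m n : ℕ, ∀ A : Finset (Slot t m), SepSub t m A n → SepSub t m Finset.univ n

/-- identification of the full sub-sector with the route's sector (transport along
`Finpartition univ`; bookkeeping only). -/
def FullSectorTransport : Prop :=
  ∀ t m n : ℕ, SepSub t m Finset.univ n → Sep t m n

/-- the D3 seam: 9 lines of quantifier plumbing — a TRIVIAL seam (modus ponens), and
`MagicSectorWitness ↔ K1` modulo the two true lemmas ⇒ violates (b) and (c). -/
theorem K1_of_sectors :
    MagicSectorWitness → SectorMonotone → FullSectorTransport → OneFactorisationBandLimit := by
  intro hW hM hT c m₀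
  obtain ⟨m, hm₀, hm1, hw⟩ := hW c m₀
  refine ⟨m, hm₀, hm1, fun e he => ?_⟩
  obtain ⟨t, A, hA⟩ := hw e he
  exact ⟨t, hT t m (m + e) (hM t m (m + e) A hA)⟩

/-! ## D4 — integer / Young-bicoset (colouring) form + span comparison -/

/-- colour-compatible cyclic orders: for a pair of `n`-colourings of the slots, the number of
bijections `q : Fin m ≃ B` whose successor slot has `κ₂`-colour equal to the `κ₁`-colour of the slot;
`colourCycle κ₁ κ₂ = v_Y` for the 0/1 matrix `Y(s,s') = [κ₁ s = κ₂ s']` of rank ≤ n. -/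
noncomputable def colourCycle (t m n : ℕ) (κ₁ κ₂ : Slot t m → Fin n) : SP t m → ℂ := fun π =>
  ∏ B ∈ π.1.parts,
    ((Finset.univ.filter fun q : Fin m ≃ ↥B => ∀ i, κ₂ (q (finRotate m i)).1 = κ₁ (q i).1).card : ℂ)

noncomputable def spanCol (t m n : ℕ) : Submodule ℂ (SP t m → ℂ) :=
  Submodule.span ℂ (Set.range fun κ : (Slot t m → Fin n) × (Slot t m → Fin n) =>
    colourCycle t m n κ.1 κ.2)

/-- `K1Comb`: the 0/1 vector `1_OF` is not a rational/complex combination of the INTEGER vectors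
`colourCycle κ₁ κ₂` — K1 with "rank ≤ n complex matrix" replaced by "pair of n-colourings". -/
def K1Comb : Prop :=
  ∀ c m₀ : ℕ, ∃ m : ℕ, m₀ ≤ m ∧ 1 ≤ m ∧
    ∀ e : ℕ, m + e ≤ windowTop c m → ∃ t : ℕ, indOF t m ∉ spanCol t m (m + e)

/-- `SpanComparison`: multilinear expansion of `v_X` over a rank factorisation `X = P Q` puts every
block-cycle vector in the span of the colouring vectors (and conversely `colourCycle = v_Y`, rank Y ≤ n),
so the two spans COINCIDE. TRUE (Schur–Weyl-free, elementary), M-sized in Lean. -/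
def SpanComparison : Prop := ∀ t m n : ℕ, spanN t m n ≤ spanCol t m n

/-- the D4 seam: 6 lines, `Submodule`-monotonicity — TRIVIAL, and `K1Comb ↔ K1` modulo the true
`SpanComparison` + its converse ⇒ violates (b) and (c). -/
theorem K1_of_comb : K1Comb → SpanComparison → OneFactorisationBandLimit := by
  intro hK hS c m₀
  obtain ⟨m, hm₀, hm1, hw⟩ := hK c m₀
  refine ⟨m, hm₀, hm1, fun e he => ?_⟩
  obtain ⟨t, ht⟩ := hw e he
  exact ⟨t, fun hmem => ht (hS t m (m + e) hmem)⟩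

/-! ## D7 — case split on the window exponent `c` : the paradigm of a trivial seam -/

def K1Below (C : ℕ) : Prop :=
  ∀ c m₀ : ℕ, c ≤ C → ∃ m : ℕ, m₀ ≤ m ∧ 1 ≤ m ∧
    ∀ e : ℕ, m + e ≤ windowTop c m → ∃ t : ℕ, Sep t m (m + e)

def K1Above (C : ℕ) : Prop :=
  ∀ c m₀ : ℕ, C < c → ∃ m : ℕ, m₀ ≤ m ∧ 1 ≤ m ∧
    ∀ e : ℕ, m + e ≤ windowTop c m → ∃ t : ℕ, Sep t m (m + e)

/-- one line: rejected by (b); and `K1Above C ↔ K1` anyway (windows grow with `c`), rejected by (c). -/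
theorem K1_of_cases (C : ℕ) : K1Below C → K1Above C → OneFactorisationBandLimit :=
  fun hb ha c m₀ => (Nat.lt_or_ge C c).elim (ha c m₀) (hb c m₀)

/-! ## D8 — de-bordering triple: the per-specific piece already implies the Statement -/

/-- `ExactQPValiant`: per_m has no EXACT quasi-polynomial-width power-trace representation, for
infinitely many m in every window (non-border qp-Valiant in the Pow model = VNP ⊄ VQBP). -/
def ExactQPValiant : Prop :=
  ∀ c m₀ : ℕ, ∃ m : ℕ, m₀ ≤ m ∧ 1 ≤ m ∧ ∀ e : ℕ, m + e ≤ windowTop c m →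
    ∀ A : Matrix (Fin (m + e)) (Fin (m + e)) (MvPolynomial (Fin m × Fin m) ℂ),
      (∀ i j, (A i j).IsHomogeneous 1) →
        (A ^ m).trace ≠ Literature.Computability.AlgebraicComplexity.perPoly (Fin m) ℂ

/-- PROVED: this piece alone closes the summit (same 12 lines as the route's `closes`, minus K1 and
minus PowTraceCertificate) — so in the triple  K1 ⇐ ExactQPValiant ∧ DeBordering ∧ Completeness
the other two pieces are decorative at route level: violates (a)/(c) (piece ≥ Statement). -/
theorem statement_of_exactQPValiant : ExactQPValiant → _root_.ValiantsHypothesis := by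
  intro hX
  show Literature.Computability.AlgebraicComplexity.VP ℂ ≠
    Literature.Computability.AlgebraicComplexity.VNP ℂ
  intro hEq
  have hper : Literature.Computability.AlgebraicComplexity.perFamily ℂ ∈
      Literature.Computability.AlgebraicComplexity.VP ℂ := by
    rw [hEq]; exact Literature.Computability.AlgebraicComplexity.perFamily_mem_VNP_holds ℂ
  have hvp : Literature.Computability.AlgebraicComplexity.IsVPFamily
      (fun n => Literature.Computability.AlgebraicComplexity.perPoly (Fin n) ℂ) :=
    (Literature.Computability.AlgebraicComplexity.mem_VP_ofFintype_iff_holds _).1 hper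
  obtain ⟨c, hc⟩ :=
    Summit.ValiantsHypothesis.ValiantsHypothesis.Theorems.perPowTraceQP_proof hvp
  obtain ⟨m, -, hm1, hwin⟩ := hX c 0
  obtain ⟨e, hle, A, hA, htr⟩ := hc m hm1
  exact hwin e hle A hA htr

/-- and K1 ∧ PowTraceCertificate give it back (the route's own `closes` factorises through it). -/
theorem exactQPValiant_of_K1 :
    OneFactorisationBandLimit → PowTraceCertificate → ExactQPValiant := by
  intro hK hC c m₀
  obtain ⟨m, hm₀, hm1, hw⟩ := hK c m₀
  refine ⟨m, hm₀, hm1, fun e he A hA => ?_⟩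
  obtain ⟨t, ht⟩ := hw e he
  exact hC m e t hm1 ht A hA

end Summit.ValiantsHypothesis.ValiantsHypothesis.Cruxes.OneFactorisationBandLimit.Census

namespace Summit.ValiantsHypothesis.ValiantsHypothesis.Cruxes.OneFactorisationBandLimit.Census

open Summit.ValiantsHypothesis.ValiantsHypothesis.Theses.SchenstedIndex

/-- the transport piece of D3 is definitional (the full sub-sector IS the route's sector). -/
theorem fullSectorTransport_holds : FullSectorTransport := fun _ _ _ h => h

/-- hence D3 is really two pieces, and its seam stays modus ponens. -/
theorem K1_of_sectors' : MagicSectorWitness → SectorMonotone → OneFactorisationBandLimit :=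
  fun hW hM => K1_of_sectors hW hM fullSectorTransport_holds

end Summit.ValiantsHypothesis.ValiantsHypothesis.Cruxes.OneFactorisationBandLimit.Census
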